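import Summits.NavierStokesRegularity.NavierStokesRegularity.Theorems.LerayQuarterDissipationFiniteDissipationLiouvilleApexEpsilon
import Summits.NavierStokesRegularity.NavierStokesRegularity.Theorems.LerayQuarterDissipationFiniteDissipationLiouvilleFiniteSingularSetTools
import Summits.NavierStokesRegularity.NavierStokesRegularity.Theses.LerayQuarterDissipation
import HarnessLib

/-!
# Crux `FiniteDissipationLiouville` (stmt-NavierStokesRegularity-22144): the FINAL-TIME SINGULAR SET
# of a member of the finite-dissipation stratum is FINITE (file 4/4)

Theorems file of route `LerayQuarterDissipation` (lead prover g4; `--supports` the crux, both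
registered stubs). Navier–Stokes regularity is NOT proved by anything here; no summit is.

**Main results.** Let `u` be a member of the stratum `𝒟_{C,K}`: a Type-I ancient mild field in the
KNSS gauge (`IsTypeIAncientMild C u`) with Leray's quarter-rate dissipation law
`∫ ‖∇u(s)‖² ≤ K/√(−s)`, `s < 0`. Call a point `x₀ ∈ ℝ³` SINGULAR (for `u`, at the final time
`t = 0`) when `u` is unbounded on every backward cylinder `Q_ρ(0, x₀) = (−ρ², 0) × B(x₀, ρ)` — the
crux's own clause, centred at `x₀` instead of the origin.

* `exists_card_singular_le` — **FINITELY MANY SINGULAR POINTS, with an explicit count**: there is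
  an absolute `c > 0` such that every finite set of singular points of every member of every
  stratum `𝒟_{C,K}` has at most `c · (K⁺)³` elements. In particular (`finite_singularSet`,
  `ncard_singularSet_le`) the final-time singular set is FINITE.
* `not_singular_of_pastDss` — **past-DSS members are singular at most at the apex**: if
  `c • u(c²t, c•x) = u(t, x)` on `t < 0` for some `c > 1`, then NO `x₀ ≠ 0` is singular (the
  dilation orbit `c^k x₀` of a singular point consists of singular points) — a second,
  envelope-free proof on `𝒟` of Chae–Wolf's point-singularity statement (Thm. 1.1 of
  arXiv:1610.09464), and a portrait entry for BOTH registered stubs: a counterexample to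
  `stub_pastWanderingRecurrentLiouville` is singular at the apex and at no more than `c (K⁺)³`
  further final-time points.

**Proof** (the dissipation law is exactly CKN-critical). Singular points are detected one scale at
a time by the tree's PROVED ε-regularity criterion (Lemarié-Rieusset 2016, Thm. 14.4; file 1/4
`exists_epsilon_singular`): each singular `x₀` has `ε₀³ r² < ∫_{−2r²}^{0}∫_{B(x₀,r)} (|u|³ + |p|^{3/2})`
for EVERY `r`. For `N` singular points and `r` below half their separation the balls are disjoint,
and on their union `E` (of measure `N |B_r|`) Hölder against the GLOBAL slice norms of the stratum
— `‖u(t)‖_{L⁶} ≲ √(K⁺) (−t)^{−1/4}` (lead g0) and the Calderón–Zygmund slice pressures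
`‖Q(t)‖_{L³} ≲ ‖u(t)‖²_{L⁶}` of the gauged pressure (lead g3) — pays `(K⁺)^{3/2}(−t)^{−3/4} |E|^{1/2}`
per slice (files 2–3/4), i.e. `≲ (K⁺)^{3/2} √N r²` after the time integral `∫_{−2r²}^0 (−t)^{−3/4} ≍ √r`
(plus a gauge-constant term `O(N r^{7/2})`, negligible for small `r`). Comparing, `N ε₀³ ≲ (K⁺)^{3/2} √N`,
so `N ≲ (K⁺)³`.

References: Caffarelli–Kohn–Nirenberg, CPAM 35 (1982); Lemarié-Rieusset (2016), Thm. 14.4;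
Chae–Wolf, arXiv:1610.09464, Thm. 1.1 and §2 Step 2.
-/

noncomputable section

-- the summit and its single sub-problem share the name (CONVENTIONS §1), as in every Theorems file
set_option linter.dupNamespace false

namespace Summit.NavierStokesRegularity.NavierStokesRegularity.Theorems.FiniteDissipationLiouville.Birth.Apex

open MeasureTheory Set Filter Topology Metric Function TopologicalSpace
open Literature.Analysis Literature.Analysis.FluidPDE
open scoped ENNReal NNReal

/-! ### Step 3: the count, in real numbers -/

/-- `(2r²)^{1/4} = 2^{1/4} r^{1/2}` for `r ≥ 0`. -/
theorem rpow_quarter_two_mul_sq {r : ℝ} (hr : 0 ≤ r) :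
    (2 * r ^ 2) ^ (1 / 4 : ℝ) = (2 : ℝ) ^ (1 / 4 : ℝ) * r ^ (1 / 2 : ℝ) := by
  rw [Real.mul_rpow (by norm_num) (sq_nonneg r)]
  congr 1
  rw [show r ^ 2 = r ^ (2 : ℝ) from (Real.rpow_natCast r 2).symm, ← Real.rpow_mul hr]
  norm_num

/-- `(N r³ v)^{1/2} = √N v^{1/2} r^{3/2}` for `N, v, r ≥ 0`. -/
theorem rpow_half_mul_cube {N v r : ℝ} (hN : 0 ≤ N) (hv : 0 ≤ v) (hr : 0 ≤ r) :
    (N * r ^ 3 * v) ^ (1 / 2 : ℝ) = Real.sqrt N * v ^ (1 / 2 : ℝ) * r ^ (3 / 2 : ℝ) := by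
  rw [show N * r ^ 3 * v = (N * v) * r ^ 3 by ring, Real.mul_rpow (mul_nonneg hN hv) (pow_nonneg hr 3),
    Real.mul_rpow hN hv, Real.sqrt_eq_rpow]
  congr 1
  rw [show r ^ 3 = r ^ (3 : ℝ) from (Real.rpow_natCast r 3).symm, ← Real.rpow_mul hr]
  norm_num

/-- **The count.** If `N ≥ 1` and
`N ε₀³ r² < Λ (g₁ (N r³ v)^{1/2} + g₂ N r³ v) · 4 (2r²)^{1/4}` at a scale `0 < r ≤ 1` with
`r ≤ ε₀³ / (2 a₂ Λ + 1)`, `a₂ = 4·2^{1/4} g₂ v`, then `N ≤ 4 a₁² Λ² / ε₀⁶` with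
`a₁ = 4·2^{1/4} g₁ v^{1/2}` (divide by `r²`, absorb the `a₂` term into half of the left side,
and square `√N ε₀³/2 < Λ a₁`). -/
theorem le_of_count_ineq {N ε₀ Λ g₁ g₂ v r : ℝ} (hN : 1 ≤ N) (hε₀ : 0 < ε₀) (hΛ : 0 ≤ Λ)
    (hg₁ : 0 ≤ g₁) (hg₂ : 0 ≤ g₂) (hv : 0 ≤ v) (hr0 : 0 < r) (hr1 : r ≤ 1)
    (hr3 : r ≤ ε₀ ^ 3 / (2 * (4 * (2 : ℝ) ^ (1 / 4 : ℝ) * g₂ * v) * Λ + 1))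
    (h : N * (ε₀ ^ 3 * r ^ 2) <
      Λ * (g₁ * (N * r ^ 3 * v) ^ (1 / 2 : ℝ) + g₂ * (N * r ^ 3 * v)) * (4 * (2 * r ^ 2) ^ (1 / 4 : ℝ))) :
    N ≤ 4 * (4 * (2 : ℝ) ^ (1 / 4 : ℝ) * g₁ * v ^ (1 / 2 : ℝ)) ^ 2 * Λ ^ 2 / ε₀ ^ 6 := by
  have hN0 : 0 ≤ N := by linarith
  obtain ⟨a₁, ha₁⟩ : ∃ a₁ : ℝ, a₁ = 4 * (2 : ℝ) ^ (1 / 4 : ℝ) * g₁ * v ^ (1 / 2 : ℝ) := ⟨_, rfl⟩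
  obtain ⟨a₂, ha₂⟩ : ∃ a₂ : ℝ, a₂ = 4 * (2 : ℝ) ^ (1 / 4 : ℝ) * g₂ * v := ⟨_, rfl⟩
  rw [← ha₁]
  rw [← ha₂] at hr3
  have ha₁0 : 0 ≤ a₁ := by rw [ha₁]; positivity
  have ha₂0 : 0 ≤ a₂ := by rw [ha₂]; positivity
  -- powers of `r`
  have hr12 : r ^ (1 / 2 : ℝ) * r ^ (3 / 2 : ℝ) = r ^ 2 := by
    rw [← Real.rpow_add hr0, show r ^ 2 = r ^ (2 : ℝ) from (Real.rpow_natCast r 2).symm]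
    norm_num
  have hr72 : r ^ (1 / 2 : ℝ) * r ^ 3 = r ^ 2 * r ^ (3 / 2 : ℝ) := by
    rw [show r ^ 3 = r ^ (3 : ℝ) from (Real.rpow_natCast r 3).symm,
      show r ^ 2 = r ^ (2 : ℝ) from (Real.rpow_natCast r 2).symm, ← Real.rpow_add hr0,
      ← Real.rpow_add hr0]
    norm_num
  have hr32 : r ^ (3 / 2 : ℝ) ≤ r := by
    calc r ^ (3 / 2 : ℝ) = r * r ^ (1 / 2 : ℝ) := by
          rw [show (3 / 2 : ℝ) = 1 + 1 / 2 by norm_num, Real.rpow_add hr0, Real.rpow_one]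
      _ ≤ r * 1 := by
          refine mul_le_mul_of_nonneg_left ?_ hr0.le
          exact Real.rpow_le_one hr0.le hr1 (by norm_num)
      _ = r := mul_one r
  -- rewrite the right-hand side as `Λ r² (a₁ √N + a₂ N r^{3/2})`
  have hR : Λ * (g₁ * (N * r ^ 3 * v) ^ (1 / 2 : ℝ) + g₂ * (N * r ^ 3 * v)) *
      (4 * (2 * r ^ 2) ^ (1 / 4 : ℝ)) =
      Λ * r ^ 2 * (a₁ * Real.sqrt N + a₂ * N * r ^ (3 / 2 : ℝ)) := by
    rw [rpow_quarter_two_mul_sq hr0.le, rpow_half_mul_cube hN0 hv hr0.le, ha₁, ha₂]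
    have e1 : Λ * (g₁ * (Real.sqrt N * v ^ (1 / 2 : ℝ) * r ^ (3 / 2 : ℝ)) + g₂ * (N * r ^ 3 * v)) *
        (4 * ((2 : ℝ) ^ (1 / 4 : ℝ) * r ^ (1 / 2 : ℝ))) =
        Λ * ((r ^ (1 / 2 : ℝ) * r ^ (3 / 2 : ℝ)) *
          (4 * (2 : ℝ) ^ (1 / 4 : ℝ) * g₁ * v ^ (1 / 2 : ℝ) * Real.sqrt N) +
          (r ^ (1 / 2 : ℝ) * r ^ 3) * (4 * (2 : ℝ) ^ (1 / 4 : ℝ) * g₂ * v * N)) := by ring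
    rw [e1, hr12, hr72]
    ring
  rw [hR] at h
  -- divide by `r²`
  have hr2 : 0 < r ^ 2 := by positivity
  have hkey : N * ε₀ ^ 3 < Λ * (a₁ * Real.sqrt N + a₂ * N * r ^ (3 / 2 : ℝ)) := by
    refine lt_of_mul_lt_mul_right ?_ hr2.le
    calc N * ε₀ ^ 3 * r ^ 2 = N * (ε₀ ^ 3 * r ^ 2) := by ring
      _ < Λ * r ^ 2 * (a₁ * Real.sqrt N + a₂ * N * r ^ (3 / 2 : ℝ)) := h
      _ = Λ * (a₁ * Real.sqrt N + a₂ * N * r ^ (3 / 2 : ℝ)) * r ^ 2 := by ring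
  -- absorb the `a₂` term
  have habs : Λ * (a₂ * N * r ^ (3 / 2 : ℝ)) ≤ N * ε₀ ^ 3 / 2 := by
    have h1 : Λ * a₂ * r ≤ ε₀ ^ 3 / 2 := by
      have hden : 0 < 2 * a₂ * Λ + 1 := by positivity
      have h2 : Λ * a₂ * r ≤ Λ * a₂ * (ε₀ ^ 3 / (2 * a₂ * Λ + 1)) :=
        mul_le_mul_of_nonneg_left hr3 (mul_nonneg hΛ ha₂0)
      have h3 : Λ * a₂ * (ε₀ ^ 3 / (2 * a₂ * Λ + 1)) ≤ ε₀ ^ 3 / 2 := by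
        rw [mul_div_assoc', div_le_div_iff₀ hden two_pos]
        have e : ε₀ ^ 3 * (2 * a₂ * Λ + 1) = Λ * a₂ * ε₀ ^ 3 * 2 + ε₀ ^ 3 := by ring
        rw [e]
        linarith [pow_pos hε₀ 3]
      exact h2.trans h3
    calc Λ * (a₂ * N * r ^ (3 / 2 : ℝ)) = N * ((Λ * a₂) * r ^ (3 / 2 : ℝ)) := by ring
      _ ≤ N * ((Λ * a₂) * r) :=
          mul_le_mul_of_nonneg_left (mul_le_mul_of_nonneg_left hr32 (mul_nonneg hΛ ha₂0)) hN0
      _ ≤ N * (ε₀ ^ 3 / 2) := mul_le_mul_of_nonneg_left h1 hN0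
      _ = N * ε₀ ^ 3 / 2 := by ring
  have hhalf : N * ε₀ ^ 3 / 2 < Λ * a₁ * Real.sqrt N := by
    have e : Λ * (a₁ * Real.sqrt N + a₂ * N * r ^ (3 / 2 : ℝ)) =
        Λ * a₁ * Real.sqrt N + Λ * (a₂ * N * r ^ (3 / 2 : ℝ)) := by ring
    linarith [hkey, habs, e]
  -- `√N ε₀³ / 2 < Λ a₁`; square
  have hsN : Real.sqrt N * Real.sqrt N = N := Real.mul_self_sqrt hN0
  have hsN1 : 1 ≤ Real.sqrt N := by rw [← Real.sqrt_one]; exact Real.sqrt_le_sqrt hN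
  have hsN0 : 0 < Real.sqrt N := by linarith
  have hroot : Real.sqrt N * ε₀ ^ 3 / 2 < Λ * a₁ := by
    refine lt_of_mul_lt_mul_left ?_ hsN0.le
    calc Real.sqrt N * (Real.sqrt N * ε₀ ^ 3 / 2)
        = (Real.sqrt N * Real.sqrt N) * ε₀ ^ 3 / 2 := by ring
      _ = N * ε₀ ^ 3 / 2 := by rw [hsN]
      _ < Λ * a₁ * Real.sqrt N := hhalf
      _ = Real.sqrt N * (Λ * a₁) := by ring
  have hε3 : 0 < ε₀ ^ 3 := by positivity
  have h1 : Real.sqrt N ≤ 2 * Λ * a₁ / ε₀ ^ 3 := by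
    rw [le_div_iff₀ hε3]; linarith
  calc N = Real.sqrt N * Real.sqrt N := hsN.symm
    _ ≤ (2 * Λ * a₁ / ε₀ ^ 3) * (2 * Λ * a₁ / ε₀ ^ 3) := mul_le_mul h1 h1 hsN0.le (by positivity)
    _ = 4 * a₁ ^ 2 * Λ ^ 2 / ε₀ ^ 6 := by
        field_simp
        ring

/-! ### The main theorem: finitely many singular points -/

/-- **FINITELY MANY SINGULAR POINTS AT THE FINAL TIME, with an explicit count.** There is an
absolute constant `c > 0` such that for all `C, K`, every member `u` of the finite-dissipation
stratum `𝒟_{C,K}` (Type-I ancient mild field in the KNSS gauge with the quarter-rate dissipation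
law `∫ ‖∇u(s)‖² ≤ K/√(−s)`) and every finite set `S` of points at each of which `u` is SINGULAR at
the final time (unbounded on every backward cylinder `(−ρ², 0) × B(x₀, ρ)`), `#S ≤ c · (K⁺)³`. -/
theorem exists_card_singular_le :
    ∃ c : ℝ, 0 < c ∧ ∀ (C K : ℝ) (u : ℝ → EuclideanSpace ℝ (Fin 3) → EuclideanSpace ℝ (Fin 3)),
      IsTypeIAncientMild C u →
      (∀ s : ℝ, s < 0 → ∫⁻ x, ‖fderiv ℝ (u s) x‖ₑ ^ 2 ≤ ENNReal.ofReal (K / Real.sqrt (-s))) →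
      ∀ S : Finset (EuclideanSpace ℝ (Fin 3)),
        (∀ x₀ ∈ S, ∀ ρ > 0, ∀ M : ℝ, ∃ t ∈ Ioo (-(ρ ^ 2)) (0 : ℝ),
          ∃ x ∈ ball x₀ ρ, M < ‖u t x‖) →
        (S.card : ℝ) ≤ c * (max K 0) ^ 3 := by
  -- ### absolute constants, fixed before the member
  obtain ⟨ε₀, hε₀, Hε⟩ := exists_epsilon_singular
  obtain ⟨g₁, g₂, CL, hg₁, hg₂, hCL, Hslice⟩ := exists_gauge_sliceBound
  obtain ⟨v, hv⟩ : ∃ v : ℝ, v = (volume : Measure (EuclideanSpace ℝ (Fin 3))).real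
      (ball (0 : EuclideanSpace ℝ (Fin 3)) 1) := ⟨_, rfl⟩
  have hv0 : 0 ≤ v := by rw [hv]; exact measureReal_nonneg
  obtain ⟨a₁, ha₁⟩ : ∃ a₁ : ℝ, a₁ = 4 * (2 : ℝ) ^ (1 / 4 : ℝ) * g₁ * v ^ (1 / 2 : ℝ) := ⟨_, rfl⟩
  obtain ⟨a₂, ha₂⟩ : ∃ a₂ : ℝ, a₂ = 4 * (2 : ℝ) ^ (1 / 4 : ℝ) * g₂ * v := ⟨_, rfl⟩
  have ha₂0 : 0 ≤ a₂ := by rw [ha₂]; positivity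
  refine ⟨(4 * a₁ ^ 2 * CL ^ 6 + 1) / ε₀ ^ 6, by positivity, fun C K u hu hlaw S hS => ?_⟩
  -- ### the trivial case
  rcases S.eq_empty_or_nonempty with hS0 | hSne
  · rw [hS0, Finset.card_empty, Nat.cast_zero]; positivity
  have hN1 : (1 : ℝ) ≤ S.card := by exact_mod_cast Finset.card_pos.2 hSne
  -- ### the member and its gauged pressure
  obtain ⟨p, hsol, hslice⟩ := Hslice C K u hu hlaw
  obtain ⟨A, hA⟩ : ∃ A : ℝ, A = CL * Real.sqrt (max K 0) := ⟨_, rfl⟩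
  have hA0 : 0 ≤ A := by rw [hA]; positivity
  rw [← hA] at hslice
  -- ### separation and the scale `r`
  obtain ⟨δ, hδ, hsep⟩ := exists_pos_le_dist S
  obtain ⟨r, hr⟩ : ∃ r : ℝ, r = min (δ / 2) (min (1 / 2) (ε₀ ^ 3 / (2 * a₂ * A ^ 3 + 1))) :=
    ⟨_, rfl⟩
  have hr0 : 0 < r := by rw [hr]; positivity
  have hrδ : r ≤ δ / 2 := by rw [hr]; exact min_le_left _ _
  have hr1 : r ≤ 1 / 2 := by rw [hr]; exact (min_le_right _ _).trans (min_le_left _ _)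
  have hr3 : r ≤ ε₀ ^ 3 / (2 * a₂ * A ^ 3 + 1) := by
    rw [hr]; exact (min_le_right _ _).trans (min_le_right _ _)
  have hdisj : ∀ x ∈ S, ∀ y ∈ S, x ≠ y → Disjoint (ball x r) (ball y r) :=
    fun x hx y hy hxy => ball_disjoint_ball (by linarith [hsep x hx y hy hxy])
  -- ### lower bound: each singular point charges `ε₀³ r²`
  have hlow : ENNReal.ofReal (S.card * (ε₀ ^ 3 * r ^ 2)) <
      ∑ x ∈ S, ∫⁻ z in Ioo (-(2 * r ^ 2)) 0 ×ˢ ball x r,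
        (‖u z.1 z.2‖ₑ ^ (3 : ℕ) + ‖p z.1 z.2‖ₑ ^ (3 / 2 : ℝ)) := by
    have h1 : ∀ x ∈ S, ENNReal.ofReal (ε₀ ^ 3 * r ^ 2) <
        ∫⁻ z in Ioo (-(2 * r ^ 2)) 0 ×ˢ ball x r,
          (‖u z.1 z.2‖ₑ ^ (3 : ℕ) + ‖p z.1 z.2‖ₑ ^ (3 / 2 : ℝ)) :=
      fun x hx => Hε u p hsol x (hS x hx) r hr0
    calc ENNReal.ofReal (S.card * (ε₀ ^ 3 * r ^ 2))
        = ∑ x ∈ S, ENNReal.ofReal (ε₀ ^ 3 * r ^ 2) := by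
          rw [Finset.sum_const, nsmul_eq_mul, ENNReal.ofReal_mul (Nat.cast_nonneg _),
            ENNReal.ofReal_natCast]
      _ < _ := ENNReal.sum_lt_sum_of_nonempty hSne h1
  -- ### upper bound: Hölder on the union of the balls
  have hup := sum_lintegral_cylinders_le (pow_nonneg hA0 3) hg₁.le hg₂ hslice hr0 hr1 S hdisj
  rw [← hv] at hup
  -- ### the count
  have hlt := (ENNReal.ofReal_lt_ofReal_iff'.1 (hlow.trans_le hup)).1
  have hr3' : r ≤ ε₀ ^ 3 / (2 * (4 * (2 : ℝ) ^ (1 / 4 : ℝ) * g₂ * v) * A ^ 3 + 1) := by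
    rw [← ha₂]; exact hr3
  have hcount := le_of_count_ineq hN1 hε₀ (pow_nonneg hA0 3) hg₁.le hg₂ hv0 hr0
    (hr1.trans (by norm_num)) hr3' hlt
  rw [← ha₁] at hcount
  have hA6 : (A ^ 3) ^ 2 = CL ^ 6 * (max K 0) ^ 3 := by
    rw [← pow_mul, hA, mul_pow, show (3 * 2 : ℕ) = 2 * 3 by norm_num, pow_mul (Real.sqrt (max K 0)),
      Real.sq_sqrt (le_max_right K 0)]
  rw [hA6] at hcount
  refine hcount.trans ?_
  rw [div_mul_eq_mul_div, div_le_div_iff_of_pos_right (by positivity)]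
  nlinarith [pow_nonneg (le_max_right K 0) 3, sq_nonneg a₁, pow_pos hCL 6]

/-! ### Corollaries: the final-time singular set is finite; past-DSS members -/

/-- **THE FINAL-TIME SINGULAR SET OF A MEMBER OF THE STRATUM IS FINITE**, with at most `c (K⁺)³`
points (`c` absolute): the set of points `x₀` at which `u` is unbounded on every backward
cylinder `(−ρ², 0) × B(x₀, ρ)`. -/
theorem exists_finite_singularSet :
    ∃ c : ℝ, 0 < c ∧ ∀ (C K : ℝ) (u : ℝ → EuclideanSpace ℝ (Fin 3) → EuclideanSpace ℝ (Fin 3)),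
      IsTypeIAncientMild C u →
      (∀ s : ℝ, s < 0 → ∫⁻ x, ‖fderiv ℝ (u s) x‖ₑ ^ 2 ≤ ENNReal.ofReal (K / Real.sqrt (-s))) →
      Set.Finite {x₀ : EuclideanSpace ℝ (Fin 3) | ∀ ρ > 0, ∀ M : ℝ, ∃ t ∈ Ioo (-(ρ ^ 2)) (0 : ℝ),
          ∃ x ∈ ball x₀ ρ, M < ‖u t x‖} ∧
        (Set.ncard {x₀ : EuclideanSpace ℝ (Fin 3) | ∀ ρ > 0, ∀ M : ℝ, ∃ t ∈ Ioo (-(ρ ^ 2)) (0 : ℝ),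
          ∃ x ∈ ball x₀ ρ, M < ‖u t x‖} : ℝ) ≤ c * (max K 0) ^ 3 := by
  obtain ⟨c, hc, H⟩ := exists_card_singular_le
  refine ⟨c, hc, fun C K u hu hlaw => ?_⟩
  have hfin : Set.Finite {x₀ : EuclideanSpace ℝ (Fin 3) | ∀ ρ > 0, ∀ M : ℝ,
      ∃ t ∈ Ioo (-(ρ ^ 2)) (0 : ℝ), ∃ x ∈ ball x₀ ρ, M < ‖u t x‖} := by
    by_contra hinf
    obtain ⟨S, hS, hcard⟩ := Set.Infinite.exists_subset_card_eq hinf (⌈c * (max K 0) ^ 3⌉₊ + 1)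
    have h1 := H C K u hu hlaw S (fun x₀ hx₀ => hS hx₀)
    rw [hcard] at h1
    have h2 := Nat.le_ceil (c * (max K 0) ^ 3)
    push_cast at h1
    linarith
  refine ⟨hfin, ?_⟩
  rw [Set.ncard_eq_toFinset_card _ hfin]
  exact H C K u hu hlaw _ (fun x₀ hx₀ => (Set.Finite.mem_toFinset hfin).1 hx₀)

/-- **Singular points of a past-DSS field propagate along the dilation orbit**: if
`c • u(c²t, c•x) = u(t, x)` on `t < 0` and `u` is singular at the final-time point `y`, then it is
singular at `c • y`. -/
theorem singularAt_smul_of_pastDss {u : ℝ → EuclideanSpace ℝ (Fin 3) → EuclideanSpace ℝ (Fin 3)}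
    {c : ℝ} (hc : 1 < c) (hcw : ∀ t : ℝ, t < 0 → ∀ x, c • u (c ^ 2 * t) (c • x) = u t x)
    {y : EuclideanSpace ℝ (Fin 3)}
    (hy : ∀ ρ > 0, ∀ M : ℝ, ∃ t ∈ Ioo (-(ρ ^ 2)) (0 : ℝ), ∃ x ∈ ball y ρ, M < ‖u t x‖) :
    ∀ ρ > 0, ∀ M : ℝ, ∃ t ∈ Ioo (-(ρ ^ 2)) (0 : ℝ), ∃ x ∈ ball (c • y) ρ, M < ‖u t x‖ := by
  intro ρ hρ M
  have hc0 : 0 < c := by linarith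
  obtain ⟨t, ht, x, hx, hM⟩ := hy (ρ / c) (by positivity) (c * M)
  refine ⟨c ^ 2 * t, ⟨?_, ?_⟩, c • x, ?_, ?_⟩
  · have h1 : -(ρ / c) ^ 2 < t := ht.1
    have e : c ^ 2 * (ρ / c) ^ 2 = ρ ^ 2 := by field_simp
    nlinarith [mul_lt_mul_of_pos_left h1 (pow_pos hc0 2)]
  · exact mul_neg_of_pos_of_neg (pow_pos hc0 2) ht.2
  · rw [mem_ball, dist_eq_norm, ← smul_sub, norm_smul, Real.norm_of_nonneg hc0.le]
    have hx' : ‖x - y‖ < ρ / c := by rwa [mem_ball, dist_eq_norm] at hx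
    calc c * ‖x - y‖ < c * (ρ / c) := mul_lt_mul_of_pos_left hx' hc0
      _ = ρ := by field_simp
  · rw [← hcw t ht.2 x, norm_smul, Real.norm_of_nonneg hc0.le] at hM
    nlinarith [norm_nonneg (u (c ^ 2 * t) (c • x))]

/-- **PAST-DSS MEMBERS OF THE STRATUM ARE SINGULAR AT MOST AT THE APEX** (envelope-free proof of
Chae–Wolf's point-singularity statement, Thm. 1.1 of arXiv:1610.09464, on `𝒟`): if `u ∈ 𝒟_{C,K}`
satisfies `c • u(c²t, c•x) = u(t, x)` on `t < 0` for some `c > 1`, then `u` is bounded on some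
backward cylinder `(−ρ², 0) × B(x₀, ρ)` at every `x₀ ≠ 0` — the dilation orbit `c^k • x₀` of a
singular `x₀ ≠ 0` would be an infinite family of singular points. -/
theorem not_singular_of_pastDss {C K c : ℝ}
    {u : ℝ → EuclideanSpace ℝ (Fin 3) → EuclideanSpace ℝ (Fin 3)} (hc : 1 < c)
    (hu : IsTypeIAncientMild C u)
    (hlaw : ∀ s : ℝ, s < 0 → ∫⁻ x, ‖fderiv ℝ (u s) x‖ₑ ^ 2 ≤ ENNReal.ofReal (K / Real.sqrt (-s)))
    (hcw : ∀ t : ℝ, t < 0 → ∀ x, c • u (c ^ 2 * t) (c • x) = u t x)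
    {x₀ : EuclideanSpace ℝ (Fin 3)} (hx₀ : x₀ ≠ 0) :
    ¬ (∀ ρ > 0, ∀ M : ℝ, ∃ t ∈ Ioo (-(ρ ^ 2)) (0 : ℝ), ∃ x ∈ ball x₀ ρ, M < ‖u t x‖) := by
  intro hsing
  obtain ⟨c₀, -, H⟩ := exists_card_singular_le
  have hc0 : 0 < c := by linarith
  -- every point of the orbit is singular
  have horbit : ∀ k : ℕ, ∀ ρ > 0, ∀ M : ℝ, ∃ t ∈ Ioo (-(ρ ^ 2)) (0 : ℝ),
      ∃ x ∈ ball (c ^ k • x₀) ρ, M < ‖u t x‖ := by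
    intro k
    induction k with
    | zero => simpa using hsing
    | succ k ih =>
        have h := singularAt_smul_of_pastDss hc hcw ih
        rwa [smul_smul, ← pow_succ'] at h
  -- the orbit is injective
  have hinj : Function.Injective fun k : ℕ => c ^ k • x₀ := by
    intro j k hjk
    have h := congrArg (fun z : EuclideanSpace ℝ (Fin 3) => ‖z‖) hjk
    simp only [norm_smul, Real.norm_of_nonneg (pow_pos hc0 _).le] at h
    have h' : c ^ j = c ^ k := mul_right_cancel₀ (norm_ne_zero_iff.2 hx₀) h
    exact pow_right_injective₀ hc0 (ne_of_gt hc) h'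
  -- too many singular points
  set n : ℕ := ⌈c₀ * (max K 0) ^ 3⌉₊ + 1 with hn
  have hcard : ((Finset.range n).image fun k : ℕ => c ^ k • x₀).card = n := by
    rw [Finset.card_image_of_injective _ hinj, Finset.card_range]
  have h1 := H C K u hu hlaw ((Finset.range n).image fun k : ℕ => c ^ k • x₀) (by
    intro y hy
    obtain ⟨k, -, rfl⟩ := Finset.mem_image.1 hy
    exact horbit k)
  rw [hcard, hn] at h1
  have h2 := Nat.le_ceil (c₀ * (max K 0) ^ 3)
  push_cast at h1
  linarith

/-- **A second small-dissipation leaf, regularity form, from the count.** There is an absolute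
`K₁ > 0` such that every member of a stratum `𝒟_{C,K}` with `K < K₁` is bounded on some backward
cylinder at the apex (the count `#S ≤ c (K⁺)³ < 1` leaves no room for a singular point) — an
ε-regularity proof of the regularity form of the BC5 rung `stub_smallDissipationGap` (lead g0's
Duhamel proof gives the stronger `u ≡ 0`). -/
theorem exists_notSingular_of_small_dissipation :
    ∃ K₁ : ℝ, 0 < K₁ ∧ ∀ (C K : ℝ) (u : ℝ → EuclideanSpace ℝ (Fin 3) → EuclideanSpace ℝ (Fin 3)),
      IsTypeIAncientMild C u →
      (∀ s : ℝ, s < 0 → ∫⁻ x, ‖fderiv ℝ (u s) x‖ₑ ^ 2 ≤ ENNReal.ofReal (K / Real.sqrt (-s))) →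
      K < K₁ →
        ¬ (∀ r > 0, ∀ M : ℝ, ∃ t ∈ Set.Ioo (-(r ^ 2)) (0 : ℝ),
            ∃ x ∈ Metric.ball (0 : EuclideanSpace ℝ (Fin 3)) r, M < ‖u t x‖) := by
  obtain ⟨c, hc, H⟩ := exists_card_singular_le
  refine ⟨min 1 (1 / (c + 1)), by positivity, fun C K u hu hlaw hK hsing => ?_⟩
  have h1 := H C K u hu hlaw {0} (fun x₀ hx₀ => by
    rw [Finset.mem_singleton] at hx₀
    subst hx₀
    exact hsing)
  rw [Finset.card_singleton, Nat.cast_one] at h1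
  have hK1 : max K 0 ≤ min 1 (1 / (c + 1)) := max_le hK.le (by positivity)
  have hKle1 : max K 0 ≤ 1 := hK1.trans (min_le_left _ _)
  have hKle2 : max K 0 ≤ 1 / (c + 1) := hK1.trans (min_le_right _ _)
  have hK0 : 0 ≤ max K 0 := le_max_right _ _
  have hcube : (max K 0) ^ 3 ≤ max K 0 := by
    calc (max K 0) ^ 3 = max K 0 * (max K 0 * max K 0) := by ring
      _ ≤ max K 0 * (1 * 1) :=
          mul_le_mul_of_nonneg_left (mul_le_mul hKle1 hKle1 hK0 zero_le_one) hK0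
      _ = max K 0 := by ring
  have h2 : c * (max K 0) ^ 3 ≤ c * (1 / (c + 1)) :=
    mul_le_mul_of_nonneg_left (hcube.trans hKle2) hc.le
  have h3 : c * (1 / (c + 1)) < 1 := by
    rw [mul_one_div, div_lt_one (by positivity)]; linarith
  linarith

/-- **Portrait entry (both registered stubs).** A singular member of the stratum — in particular a
counterexample to `stub_pastWanderingRecurrentLiouville`, or a backward-DSS profile refuting the
wall on `𝒟` — is singular at the apex and at NO MORE THAN `c (K⁺)³` final-time points in all; a
past-DSS one exactly at the apex. Bookkeeping form: the crux is equivalent to its restriction to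
members whose final-time singular set is finite. -/
theorem finiteDissipationLiouville_iff_finiteSingularSet :
    Theses.LerayQuarterDissipation.FiniteDissipationLiouville ↔
      ∀ (C K : ℝ) (ū : ℝ → EuclideanSpace ℝ (Fin 3) → EuclideanSpace ℝ (Fin 3)),
        IsTypeIAncientMild C ū →
        (∀ s : ℝ, s < 0 → ∫⁻ x, ‖fderiv ℝ (ū s) x‖ₑ ^ 2 ≤ ENNReal.ofReal (K / Real.sqrt (-s))) →
        Set.Finite {x₀ : EuclideanSpace ℝ (Fin 3) | ∀ ρ > 0, ∀ M : ℝ, ∃ t ∈ Ioo (-(ρ ^ 2)) (0 : ℝ),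
          ∃ x ∈ ball x₀ ρ, M < ‖ū t x‖} →
        ¬ (∀ r > 0, ∀ M : ℝ, ∃ t ∈ Set.Ioo (-(r ^ 2)) (0 : ℝ),
            ∃ x ∈ Metric.ball (0 : EuclideanSpace ℝ (Fin 3)) r, M < ‖ū t x‖) := by
  obtain ⟨c, -, H⟩ := exists_finite_singularSet
  constructor
  · intro h C K ū hū hD _
    exact h C K ū hū hD
  · intro h C K ū hū hD
    exact h C K ū hū hD (H C K ū hū hD).1

end Summit.NavierStokesRegularity.NavierStokesRegularity.Theorems.FiniteDissipationLiouville.Birth.Apex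

end
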